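import Mathlib.Analysis.Complex.Liouville

/-!
# Stub `stub_biaffine` of line `lee-yang-mass-handover`
(crux `Summit.QuantumFields.QCD.Theses.HeatSlicedQuarks.RobustYangMillsHandover`,
item stmt-QuantumFields-8892)

**The bi-affine Lebowitz–Penrose bound.**  If the bi-affine polynomial
`1 + σ a + τ b + σ τ c` has no zero in the polydisc `‖σ‖ < ρ`, `‖τ‖ < ρ` (`ρ > 0`), then
`‖c − a b‖ ≤ 1/ρ²`.  With `a = ⟨A⟩`, `b = ⟨τ_n B⟩`, `c = ⟨A τ_n B⟩` this turns zero-freeness of the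
partition function dressed with two affine sources, `Z·⟨(1 + σA)(1 + τ τ_nB)⟩ = Z(1 + σa + τb + στc)`, into
the volume-blind bound `‖⟨A; τ_nB⟩‖ ≤ ρ⁻²` on the connected correlator (Lebowitz–Penrose 1968, transplanted
from the magnetic field to any complex parameter).

Proof.  For `‖τ‖ < ρ` the point `σ = 0` gives `1 + τ b ≠ 0`, and `g τ := (a + τ c)/(1 + τ b)` satisfies
`‖g τ‖ ≤ 1/ρ` (otherwise `σ := −(g τ)⁻¹` lies in the disc and is a zero, since
`1 + σa + τb + στc = (1 + τb)(1 + σ g τ)`).  `g` is holomorphic on `‖τ‖ < ρ` with `g′(0) = c − ab`; Cauchy's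
estimate on the circle of radius `r < ρ` gives `‖c − ab‖ ≤ (1/ρ)/r`, and `r ↑ ρ` concludes.

Pure Mathlib complex analysis; no project definitions.
-/

namespace Summit.QuantumFields.QCD.Cruxes.RobustYangMillsHandover.LeeYangMassHandover

open Complex Metric Set

/-- **Bi-affine zero-freeness bounds the connected part**: if `1 + σ a + τ b + σ τ c ≠ 0` whenever
`‖σ‖ < ρ` and `‖τ‖ < ρ`, then `‖c − a b‖ ≤ 1 / ρ²`. [folklore] -/
theorem stub_biaffine :
    ∀ ρ : ℝ, 0 < ρ → ∀ a b c : ℂ,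
      (∀ σ τ : ℂ, ‖σ‖ < ρ → ‖τ‖ < ρ → 1 + σ * a + τ * b + σ * τ * c ≠ 0) →
        ‖c - a * b‖ ≤ 1 / ρ ^ 2 := by
  intro ρ hρ a b c hzf
  -- the denominator never vanishes on the disc
  have hden : ∀ τ : ℂ, ‖τ‖ < ρ → 1 + τ * b ≠ 0 := by
    intro τ hτ
    have h := hzf 0 τ (by simpa using hρ) hτ
    simpa using h
  -- the Möbius-type function and its bound
  set g : ℂ → ℂ := fun τ => (a + τ * c) / (1 + τ * b) with hg
  have hgb : ∀ τ : ℂ, ‖τ‖ < ρ → ‖g τ‖ ≤ 1 / ρ := by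
    intro τ hτ
    by_contra hlt
    push Not at hlt
    have hgpos : 0 < ‖g τ‖ := (div_pos one_pos hρ).trans hlt
    have hg0 : g τ ≠ 0 := norm_pos_iff.mp hgpos
    set σ : ℂ := -(g τ)⁻¹ with hσ
    have hσn : ‖σ‖ < ρ := by
      rw [hσ, norm_neg, norm_inv]
      rw [inv_lt_comm₀ hgpos hρ]
      simpa [one_div] using hlt
    have hnum : a + τ * c = g τ * (1 + τ * b) := by
      rw [hg]
      field_simp [hden τ hτ]
    have hzero : 1 + σ * a + τ * b + σ * τ * c = 0 := by
      have : 1 + σ * a + τ * b + σ * τ * c = (1 + τ * b) + σ * (a + τ * c) := by ring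
      rw [this, hnum, hσ]
      field_simp
      ring
    exact hzf σ τ hσn hτ hzero
  -- `g` is holomorphic on the disc with `g′(0) = c − a b`
  have hderiv : HasDerivAt g (c - a * b) 0 := by
    have h1 : HasDerivAt (fun τ : ℂ => a + τ * c) c 0 := by
      simpa using ((hasDerivAt_id (0 : ℂ)).mul_const c).const_add a
    have h2 : HasDerivAt (fun τ : ℂ => 1 + τ * b) b 0 := by
      simpa using ((hasDerivAt_id (0 : ℂ)).mul_const b).const_add 1
    have h3 := h1.div h2 (by simp)
    simp only [zero_mul, add_zero, mul_one, one_pow, div_one] at h3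
    exact h3
  have hdiff : DifferentiableOn ℂ g (ball (0 : ℂ) ρ) := by
    intro τ hτ
    have hτ' : ‖τ‖ < ρ := by simpa using hτ
    apply DifferentiableAt.differentiableWithinAt
    apply DifferentiableAt.div
    · fun_prop
    · fun_prop
    · exact hden τ hτ'
  -- Cauchy's estimate on every circle of radius `r < ρ`
  have hcauchy : ∀ r : ℝ, 0 < r → r < ρ → ‖c - a * b‖ ≤ (1 / ρ) / r := by
    intro r hr hrρ
    have hdc : DiffContOnCl ℂ g (ball (0 : ℂ) r) := by
      refine (hdiff.mono ?_).diffContOnCl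
      rw [closure_ball (0 : ℂ) hr.ne']
      exact closedBall_subset_ball hrρ
    have hC : ∀ z ∈ sphere (0 : ℂ) r, ‖g z‖ ≤ 1 / ρ := by
      intro z hz
      apply hgb
      have : ‖z‖ = r := by simpa using hz
      rw [this]; exact hrρ
    have key := Complex.norm_deriv_le_of_forall_mem_sphere_norm_le hr hdc hC
    rwa [hderiv.deriv] at key
  -- let `r ↑ ρ`
  by_contra hlt
  push Not at hlt
  have hcab : 0 < ‖c - a * b‖ := (div_pos one_pos (pow_pos hρ 2)).trans hlt
  -- choose `r` with `1/(ρ ‖c - ab‖) < r < ρ`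
  have hlow : 1 / (ρ * ‖c - a * b‖) < ρ := by
    rw [div_lt_iff₀ (mul_pos hρ hcab)]
    have : 1 / ρ ^ 2 * ρ ^ 2 = 1 := by field_simp
    nlinarith [hlt, pow_pos hρ 2]
  obtain ⟨r, hr1, hr2⟩ := exists_between hlow
  have hr0 : 0 < r := (div_pos one_pos (mul_pos hρ hcab)).trans hr1
  have key := hcauchy r hr0 hr2
  -- `(1/ρ)/r < ‖c - ab‖` since `r > 1/(ρ ‖c - ab‖)`
  have : (1 / ρ) / r < ‖c - a * b‖ := by
    rw [div_lt_iff₀ hr0]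
    rw [div_lt_iff₀ (mul_pos hρ hcab)] at hr1
    calc 1 / ρ = (1 : ℝ) * (1 / ρ) := by ring
      _ < r * (ρ * ‖c - a * b‖) * (1 / ρ) := by
          apply mul_lt_mul_of_pos_right hr1 (div_pos one_pos hρ)
      _ = ‖c - a * b‖ * r := by field_simp
  linarith

end Summit.QuantumFields.QCD.Cruxes.RobustYangMillsHandover.LeeYangMassHandover
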